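import Mathlib
import Summits.NavierStokesRegularity.FluidComputer.AbcClassIIBasesPrep
import Summits.NavierStokesRegularity.FluidComputer.AbcClassIIOpenBracket

/-!
# GROUP-B END-TO-END ON THE MODEL, CLASS II — ARBITRARY ORBIT BASES (prep): band, growth, section
# pairing of the first-order matrix `am` in an arbitrary family of orbit bases
(profile-cert-3 g7, cell `ns-blowup`, 2026-08-27)

HONEST FRAMING (human rulings D-0035/D-0074): nothing here is a claim about Navier–Stokes blow-up.
WHAT THIS IS NOT: not NS evidence. MODEL lane (NS linearised about the forced ABC flow `abcFlow 1 1 1`,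
class II); no certificate, number or census word moves. Sequel of instab4 g7's `AbcClassIIBasesPrep`
(for ANY family `e O` of real orthonormal bases of the class-II orbit spaces `realSpace O`: basis families
`bf`, first-order matrix `am`, change-of-basis kernel `Q i j = Re Σ_k ⟪bfam i k, bf j k⟫`, orthogonal on
orbit-saturated index sets, `am = Qᵀ amat Q`). Three of the four inputs the GROUP-B instantiation
`AbcClassIIEigenpair.isLinNSEigenvalue_near_of_nested_certificate` needs about the matrix, now for `am`:

* `eam_eq_zero_of_not_mem` — BAND: `am i j = 0` off `nbrIdx i`;
* `abs_eam_le` — GROWTH: `|am i j| ≤ 288 · 2592 √(1 + |O_j|²)` (Cauchy–Schwarz on the orthogonal blocks);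
* `re_section_pairing_eam` — SECTION PAIRING on every finite index set with `s = √2`, stated in the
  single-sum form `Re Σ_i conj(c_i) Σ_j am_ij c_j ≤ √2 Σ |c_i|²` (`c ↦ f = Q c` is an isometry on saturated
  sets and `cᴴ am c = fᴴ amat f`; then instab3's `AbcClassIIOpenBracket.section_pairing_amat`);
(the coordinate transfer back to the existential basis is the sequel `AbcClassIIEigenpairBasesTransfer`).
Mathlib + the files named; no new definitions. bears_on LADDER-NS N5 / Z4-a(1). [folklore].
-/

noncomputable section

open scoped BigOperators ComplexConjugate InnerProductSpace Matrix
open Finset Matrix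

namespace Summit.NavierStokesRegularity.FluidComputer.AbcClassIIEigenpair

open Literature.Analysis.FunctionSpaces Literature.Analysis.FunctionSpaces.Torus
open Literature.Analysis.FunctionSpaces.EuclideanSpace
open Literature.Analysis.FluidPDE Literature.Analysis.FluidPDE.SteadyLattice
open Summit.NavierStokesRegularity.FluidComputer.AbcClassII

section Bases

variable (e : ∀ O : Orbit, OrthonormalBasis (Fin (odim O)) ℝ (realSpace O.1))
variable (bf : Idx → Fam)
variable (hbf : ∀ i : Idx, bf i = extend i.1.1 ((e i.1 i.2 : realSpace i.1.1) : EuclideanSpace ℂ (↥i.1.1 × Fin 3)))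
variable (am : Idx → Idx → ℝ)
variable (ham : ∀ i j : Idx, am i j =
  (∑ k ∈ i.1.1, (inner ℂ (bf i k) (Torus.lerayCoeff k (crossForm 1 1 1 (bf j) k)) : ℂ)).re)

/-- The columns of the orthogonal change-of-basis matrix have `ℓ¹`-norm `≤ √288`. -/
theorem sum_abs_coefM_le (O : Orbit) (b : Fin (odim O)) :
    ∑ a : Fin (odim O), |((orbitBasis O).toBasis.toMatrix (e O)) a b| ≤ Real.sqrt 288 := by
  set M := (orbitBasis O).toBasis.toMatrix (e O) with hM
  have h1 := Finset.sum_mul_sq_le_sq_mul_sq (Finset.univ : Finset (Fin (odim O)))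
    (fun a => |M a b|) (fun _ => (1 : ℝ))
  have h2 : ∑ a : Fin (odim O), |M a b| ^ 2 = 1 := by
    simp_rw [sq_abs, sq]
    have := coefM_orth_cols e O b b
    rw [if_pos rfl] at this
    exact this
  have h3 : ∑ _a : Fin (odim O), (1 : ℝ) ^ 2 = (odim O : ℝ) := by simp
  have h4 : (odim O : ℝ) ≤ 288 := by exact_mod_cast odim_le O
  simp only [mul_one] at h1
  rw [h2, h3, one_mul] at h1
  have h5 : 0 ≤ ∑ a : Fin (odim O), |M a b| := Finset.sum_nonneg fun _ _ => abs_nonneg _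
  calc ∑ a : Fin (odim O), |M a b| = Real.sqrt ((∑ a : Fin (odim O), |M a b|) ^ 2) :=
        (Real.sqrt_sq h5).symm
    _ ≤ Real.sqrt 288 := Real.sqrt_le_sqrt (h1.trans h4)

section
include hbf ham

/-- **BAND in arbitrary orbit bases**: `am i j = 0` unless `j ∈ nbrIdx i` (the band depends on the
orbits only). -/
theorem eam_eq_zero_of_not_mem {i j : Idx} (h : j ∉ nbrIdx i) : am i j = 0 := by
  rw [ham, eamat_eq e bf hbf i j]
  refine Finset.sum_eq_zero fun a _ => Finset.sum_eq_zero fun a' _ => ?_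
  have h' : (⟨j.1, a'⟩ : Idx) ∉ nbrIdx (⟨i.1, a⟩ : Idx) := fun hm => by
    have h2 : j.1 ∈ nbrOrbits i.1 := (mem_nbrIdx (i := (⟨i.1, a⟩ : Idx)) (j := ⟨j.1, a'⟩)).mp hm
    exact h (mem_nbrIdx.mpr h2)
  rw [amat_eq_zero_of_not_mem h', mul_zero]

/-- **GROWTH in arbitrary orbit bases**: `|am i j| ≤ 288 · 2592 √(1 + |O_j|²)`. -/
theorem abs_eam_le (i j : Idx) : |am i j| ≤ 288 * (2592 * Real.sqrt (1 + onormSq j.1)) := by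
  rw [ham, eamat_eq e bf hbf i j]
  set M := (orbitBasis i.1).toBasis.toMatrix (e i.1) with hM
  set M' := (orbitBasis j.1).toBasis.toMatrix (e j.1) with hM'
  set G := 2592 * Real.sqrt (1 + onormSq j.1) with hG
  have hG0 : 0 ≤ G := by positivity
  calc |∑ a : Fin (odim i.1), ∑ a' : Fin (odim j.1), M a i.2 * M' a' j.2 * amat ⟨i.1, a⟩ ⟨j.1, a'⟩|
      ≤ ∑ a : Fin (odim i.1), ∑ a' : Fin (odim j.1), |M a i.2| * |M' a' j.2| * G := by
        refine (Finset.abs_sum_le_sum_abs _ _).trans (Finset.sum_le_sum fun a _ => ?_)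
        refine (Finset.abs_sum_le_sum_abs _ _).trans (Finset.sum_le_sum fun a' _ => ?_)
        rw [abs_mul, abs_mul]
        exact mul_le_mul_of_nonneg_left (abs_amat_le ⟨i.1, a⟩ ⟨j.1, a'⟩) (by positivity)
    _ = (∑ a : Fin (odim i.1), |M a i.2|) * (∑ a' : Fin (odim j.1), |M' a' j.2|) * G := by
        symm
        rw [Finset.sum_mul_sum, Finset.sum_mul]
        exact Finset.sum_congr rfl fun a _ => by rw [Finset.sum_mul]
    _ ≤ Real.sqrt 288 * Real.sqrt 288 * G :=
        mul_le_mul_of_nonneg_right (mul_le_mul (sum_abs_coefM_le e i.1 i.2)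
          (sum_abs_coefM_le e j.1 j.2) (Finset.sum_nonneg fun _ _ => abs_nonneg _)
          (Real.sqrt_nonneg _)) hG0
    _ = 288 * G := by rw [Real.mul_self_sqrt (by norm_num)]

/-- **SECTION PAIRING in arbitrary orbit bases**: for every finite index set `F` and complex
coefficients, `Re Σ_{i,j ∈ F} conj(c_i) am_ij c_j ≤ √2 Σ_{i ∈ F} |c_i|²`. -/
theorem re_section_pairing_eam (F : Finset Idx) (c : Idx → ℂ) :
    RCLike.re (∑ i ∈ F, conj (c i) * ∑ j ∈ F, ((am i j : ℝ) : ℂ) * c j) ≤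
      Real.sqrt 2 * ∑ i ∈ F, ‖c i‖ ^ 2 := by
  classical
  -- the double-sum form
  have hds : ∑ i ∈ F, conj (c i) * ∑ j ∈ F, ((am i j : ℝ) : ℂ) * c j =
      ∑ i ∈ F, ∑ j ∈ F, conj (c i) * ((am i j : ℝ) : ℂ) * c j := by
    refine Finset.sum_congr rfl fun i _ => ?_
    rw [Finset.mul_sum]
    exact Finset.sum_congr rfl fun j _ => by ring
  rw [hds]
  -- saturate `F` to a cube and zero-pad the coefficients
  obtain ⟨n, hn⟩ : ∃ n, F ⊆ cubeIdx n :=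
    ⟨F.sup fun i => osupNorm i.1, fun i hi =>
      mem_cubeIdx.mpr (Finset.le_sup (f := fun i : Idx => osupNorm i.1) hi)⟩
  have hT : ∀ i ∈ cubeIdx n, ∀ a : Fin (odim i.1), (⟨i.1, a⟩ : Idx) ∈ cubeIdx n :=
    fun i hi a => cubeIdx_saturated n hi a
  set c' : Idx → ℂ := fun i => if i ∈ F then c i else 0 with hc'
  have hcF : ∀ i ∈ F, c' i = c i := fun i hi => by simp [hc', hi]
  have hc0 : ∀ i, i ∉ F → c' i = 0 := fun i hi => by simp [hc', hi]
  have e1 : ∑ i ∈ F, ∑ j ∈ F, conj (c i) * ((am i j : ℝ) : ℂ) * c j =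
      ∑ i ∈ cubeIdx n, ∑ j ∈ cubeIdx n, conj (c' i) * ((am i j : ℝ) : ℂ) * c' j := by
    rw [← Finset.sum_subset hn (fun i _ hi => by
      rw [Finset.sum_eq_zero fun j _ => by rw [hc0 i hi, map_zero, zero_mul, zero_mul]])]
    refine Finset.sum_congr rfl fun i hi => ?_
    rw [← Finset.sum_subset hn (fun j _ hj => by rw [hc0 j hj, mul_zero])]
    exact Finset.sum_congr rfl fun j hj => by rw [hcF i hi, hcF j hj]
  have e2 : ∑ i ∈ F, ‖c i‖ ^ 2 = ∑ i ∈ cubeIdx n, ‖c' i‖ ^ 2 := by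
    rw [← Finset.sum_subset hn (fun j _ hj => by rw [hc0 j hj, norm_zero, zero_pow two_ne_zero])]
    exact Finset.sum_congr rfl fun j hj => by rw [hcF j hj]
  rw [e1, e2]
  -- the change of coordinates `f = Q c'`
  set Q : Idx → Idx → ℝ := fun i j => (∑ k ∈ i.1.1, (inner ℂ (bfam i k) (bf j k) : ℂ)).re with hQ
  set f : Idx → ℂ := fun a => ∑ j ∈ cubeIdx n, ((Q a j : ℝ) : ℂ) * c' j with hf
  have ham' : ∀ i ∈ cubeIdx n, ∀ j ∈ cubeIdx n, ((am i j : ℝ) : ℂ) =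
      ∑ a ∈ cubeIdx n, ∑ a' ∈ cubeIdx n,
        ((Q a i : ℝ) : ℂ) * ((amat a a' : ℝ) : ℂ) * ((Q a' j : ℝ) : ℂ) := by
    intro i hi j hj
    rw [ham, eamat_eq_sum e bf hbf hT hT hi hj]
    push_cast
    rfl
  -- step 1: for fixed `i`, `Σ_j am_ij c'_j = Σ_a Q_ai Σ_a' amat_aa' f_a'`
  have step1 : ∀ i ∈ cubeIdx n, ∑ j ∈ cubeIdx n, ((am i j : ℝ) : ℂ) * c' j =
      ∑ a ∈ cubeIdx n, ((Q a i : ℝ) : ℂ) * ∑ a' ∈ cubeIdx n, ((amat a a' : ℝ) : ℂ) * f a' := by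
    intro i hi
    calc ∑ j ∈ cubeIdx n, ((am i j : ℝ) : ℂ) * c' j
        = ∑ j ∈ cubeIdx n, ∑ a ∈ cubeIdx n, ∑ a' ∈ cubeIdx n,
            ((Q a i : ℝ) : ℂ) * ((amat a a' : ℝ) : ℂ) * ((Q a' j : ℝ) : ℂ) * c' j := by
          refine Finset.sum_congr rfl fun j hj => ?_
          rw [ham' i hi j hj, Finset.sum_mul]
          refine Finset.sum_congr rfl fun a _ => ?_
          rw [Finset.sum_mul]
      _ = ∑ a ∈ cubeIdx n, ∑ a' ∈ cubeIdx n, ∑ j ∈ cubeIdx n,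
            ((Q a i : ℝ) : ℂ) * ((amat a a' : ℝ) : ℂ) * ((Q a' j : ℝ) : ℂ) * c' j := by
          rw [Finset.sum_comm]
          exact Finset.sum_congr rfl fun a _ => Finset.sum_comm
      _ = ∑ a ∈ cubeIdx n, ((Q a i : ℝ) : ℂ) * ∑ a' ∈ cubeIdx n, ((amat a a' : ℝ) : ℂ) * f a' := by
          refine Finset.sum_congr rfl fun a _ => ?_
          rw [Finset.mul_sum]
          refine Finset.sum_congr rfl fun a' _ => ?_
          rw [hf, Finset.mul_sum, Finset.mul_sum]
          exact Finset.sum_congr rfl fun j _ => by ring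
  -- step 2: `Σ_i conj(c'_i) Σ_a Q_ai g_a = Σ_a conj(f_a) g_a`
  have hconjf : ∀ a, conj (f a) = ∑ i ∈ cubeIdx n, ((Q a i : ℝ) : ℂ) * conj (c' i) := fun a => by
    rw [hf, map_sum]
    exact Finset.sum_congr rfl fun i _ => by rw [map_mul, Complex.conj_ofReal]
  have step2 : ∑ i ∈ cubeIdx n, ∑ j ∈ cubeIdx n, conj (c' i) * ((am i j : ℝ) : ℂ) * c' j =
      ∑ a ∈ cubeIdx n, ∑ a' ∈ cubeIdx n, conj (f a) * ((amat a a' : ℝ) : ℂ) * f a' := by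
    calc ∑ i ∈ cubeIdx n, ∑ j ∈ cubeIdx n, conj (c' i) * ((am i j : ℝ) : ℂ) * c' j
        = ∑ i ∈ cubeIdx n, conj (c' i) * ∑ j ∈ cubeIdx n, ((am i j : ℝ) : ℂ) * c' j := by
          refine Finset.sum_congr rfl fun i _ => ?_
          rw [Finset.mul_sum]
          exact Finset.sum_congr rfl fun j _ => by ring
      _ = ∑ i ∈ cubeIdx n, ∑ a ∈ cubeIdx n, conj (c' i) * (((Q a i : ℝ) : ℂ) *
            ∑ a' ∈ cubeIdx n, ((amat a a' : ℝ) : ℂ) * f a') := by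
          refine Finset.sum_congr rfl fun i hi => ?_
          rw [step1 i hi, Finset.mul_sum]
      _ = ∑ a ∈ cubeIdx n, ∑ i ∈ cubeIdx n, conj (c' i) * (((Q a i : ℝ) : ℂ) *
            ∑ a' ∈ cubeIdx n, ((amat a a' : ℝ) : ℂ) * f a') := Finset.sum_comm
      _ = ∑ a ∈ cubeIdx n, conj (f a) * ∑ a' ∈ cubeIdx n, ((amat a a' : ℝ) : ℂ) * f a' := by
          refine Finset.sum_congr rfl fun a _ => ?_
          rw [hconjf a, Finset.sum_mul]
          exact Finset.sum_congr rfl fun i _ => by ring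
      _ = ∑ a ∈ cubeIdx n, ∑ a' ∈ cubeIdx n, conj (f a) * ((amat a a' : ℝ) : ℂ) * f a' := by
          refine Finset.sum_congr rfl fun a _ => ?_
          rw [Finset.mul_sum]
          exact Finset.sum_congr rfl fun a' _ => by ring
  -- the isometry `Σ_a |f_a|² = Σ_i |c'_i|²`
  have hiso : ∑ a ∈ cubeIdx n, ‖f a‖ ^ 2 = ∑ i ∈ cubeIdx n, ‖c' i‖ ^ 2 := by
    have h1 : ∀ a, ((‖f a‖ ^ 2 : ℝ) : ℂ) = ∑ i ∈ cubeIdx n, ∑ i' ∈ cubeIdx n,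
        ((Q a i * Q a i' : ℝ) : ℂ) * (conj (c' i) * c' i') := by
      intro a
      rw [← Complex.normSq_eq_norm_sq, ← Complex.mul_conj, mul_comm, hconjf a, hf, Finset.sum_mul]
      refine Finset.sum_congr rfl fun i _ => ?_
      rw [Finset.mul_sum]
      refine Finset.sum_congr rfl fun i' _ => ?_
      push_cast
      ring
    have h2 : ((∑ a ∈ cubeIdx n, ‖f a‖ ^ 2 : ℝ) : ℂ) = ((∑ i ∈ cubeIdx n, ‖c' i‖ ^ 2 : ℝ) : ℂ) := by
      push_cast
      calc ∑ a ∈ cubeIdx n, ((‖f a‖ : ℂ)) ^ 2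
          = ∑ a ∈ cubeIdx n, ∑ i ∈ cubeIdx n, ∑ i' ∈ cubeIdx n,
              ((Q a i * Q a i' : ℝ) : ℂ) * (conj (c' i) * c' i') := by
            refine Finset.sum_congr rfl fun a _ => ?_
            rw [← h1 a]; push_cast; ring
        _ = ∑ i ∈ cubeIdx n, ∑ i' ∈ cubeIdx n, ∑ a ∈ cubeIdx n,
              ((Q a i * Q a i' : ℝ) : ℂ) * (conj (c' i) * c' i') := by
            rw [Finset.sum_comm]
            exact Finset.sum_congr rfl fun i _ => Finset.sum_comm
        _ = ∑ i ∈ cubeIdx n, ∑ i' ∈ cubeIdx n,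
              ((if i = i' then (1 : ℝ) else 0 : ℝ) : ℂ) * (conj (c' i) * c' i') := by
            refine Finset.sum_congr rfl fun i hi => Finset.sum_congr rfl fun i' hi' => ?_
            rw [← Finset.sum_mul, ← sum_coefQ_cols e bf hbf hT hi hi']
            push_cast
            rfl
        _ = ∑ i ∈ cubeIdx n, ((‖c' i‖ : ℂ)) ^ 2 := by
            refine Finset.sum_congr rfl fun i hi => ?_
            rw [Finset.sum_eq_single i (fun i' _ hne => by rw [if_neg (Ne.symm hne)]; simp)
              (fun h => absurd hi h)]
            rw [if_pos rfl, mul_comm ((starRingEnd ℂ) (c' i)) (c' i), Complex.mul_conj,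
              Complex.normSq_eq_norm_sq]
            push_cast
            ring
    exact_mod_cast h2
  rw [step2, ← hiso]
  exact AbcClassIIOpenBracket.section_pairing_amat (cubeIdx n) f

end

end Bases

end Summit.NavierStokesRegularity.FluidComputer.AbcClassIIEigenpair

end
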